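import Literature.Topology.PlaneTopology.AnnulusArcs
import HarnessLib

/-!
# Boundary budget (U6), unit BB2: disjoint exterior connectors in the round model

Crux `SAWLeftRightFKG.FKGToTraversalBound` (stmt-CriticalPhenomena-1878), line `slit-necklace`, lead
prover-line-stmt-CriticalPhenomena-1878-c5-0; witness unit U6 (the boundary budget), part BB2.

* `bb_round_connectors` (registered) — for circle points at angles `θ₁ < θ₂ < θ₄ < θ₃ < θ₁ + 2π` there
  are paths `P : e^{iθ₁} ⟶ e^{iθ₃}` and `Q : e^{iθ₂} ⟶ e^{iθ₄}` of the plane which stay outside the closed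
  unit disc except at their endpoints and are disjoint.  Construction: `P` runs radially out to radius
  `2`, along the circle of radius `2` from angle `θ₁` to `θ₃`, and radially back; `Q` does the same at
  radius `3 / 2` between the angles `θ₂` and `θ₄`.  Disjointness is norm / angle bookkeeping
  (`eq_of_circleMap_eq`).

All statements folklore (elementary plane geometry); no literature fact; nothing restates the crux.
-/

noncomputable section

open Set Metric
open Literature.Topology.PlaneTopology

namespace Summit.CriticalPhenomena.SAWScalingLimit.Theorems.FKGToTraversalBound.SlitNecklace

/-- The radial map `ρ ↦ ρ e^{iθ}` is continuous in the radius. [folklore] -/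
private theorem bbr_continuous_radial (θ : ℝ) : Continuous fun ρ : ℝ => circleMap 0 ρ θ := by
  unfold circleMap
  fun_prop

/-- **One exterior connector.**  For `θ ≤ θ'` and `1 < r` there is a path from `e^{iθ}` to `e^{iθ'}`
(radially out to radius `r`, along the circle of radius `r`, radially back) all of whose points are
`ρ e^{iφ}` with `1 ≤ ρ ≤ r` and either `φ ∈ {θ, θ'}` (the radial pieces) or `ρ = r`, `θ ≤ φ ≤ θ'`
(the arc); in particular it stays outside the closed unit disc except at its two endpoints. [folklore] -/
private theorem bbr_connector {θ θ' r : ℝ} (hθ : θ ≤ θ') (hr : 1 < r) :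
    ∃ P : Path (circleMap 0 1 θ) (circleMap 0 1 θ'),
      (∀ t, 1 ≤ ‖P t‖) ∧ (∀ t, ‖P t‖ = 1 → P t = circleMap 0 1 θ ∨ P t = circleMap 0 1 θ') ∧
      ∀ t, ∃ ρ φ : ℝ, P t = circleMap 0 ρ φ ∧ 1 ≤ ρ ∧ ρ ≤ r ∧
        ((φ = θ ∨ φ = θ') ∨ (ρ = r ∧ θ ≤ φ ∧ φ ≤ θ')) := by
  have hr' : (1 : ℝ) ≤ r := hr.le
  obtain ⟨P, hP⟩ : ∃ P : Path (circleMap 0 1 θ) (circleMap 0 1 θ'), range P =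
      (fun ρ : ℝ => circleMap 0 ρ θ) '' Icc 1 r ∪
        (circleMap 0 r '' Icc θ θ' ∪ (fun ρ : ℝ => circleMap 0 ρ θ') '' Icc 1 r) := by
    refine ⟨((Path.segment (1 : ℝ) r).map (bbr_continuous_radial θ)).trans
      ((circleArc 0 r θ θ').trans ((Path.segment r (1 : ℝ)).map (bbr_continuous_radial θ'))), ?_⟩
    rw [Path.trans_range, Path.trans_range, Path.map_coe, Path.map_coe, range_comp, range_comp,
      Path.range_segment, Path.range_segment, segment_eq_Icc hr', segment_symm ℝ r 1,
      segment_eq_Icc hr', range_circleArc, uIcc_of_le hθ]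
  have hdesc : ∀ t, ∃ ρ φ : ℝ, P t = circleMap 0 ρ φ ∧ 1 ≤ ρ ∧ ρ ≤ r ∧
      ((φ = θ ∨ φ = θ') ∨ (ρ = r ∧ θ ≤ φ ∧ φ ≤ θ')) := by
    intro t
    have hmem : P t ∈ range P := mem_range_self t
    rw [hP] at hmem
    rcases hmem with ⟨ρ, ⟨h1, h2⟩, hρ⟩ | ⟨φ, ⟨h1, h2⟩, hφ⟩ | ⟨ρ, ⟨h1, h2⟩, hρ⟩
    · exact ⟨ρ, θ, hρ.symm, h1, h2, Or.inl (Or.inl rfl)⟩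
    · exact ⟨r, φ, hφ.symm, hr', le_rfl, Or.inr ⟨rfl, h1, h2⟩⟩
    · exact ⟨ρ, θ', hρ.symm, h1, h2, Or.inl (Or.inr rfl)⟩
  refine ⟨P, fun t => ?_, fun t ht => ?_, hdesc⟩
  · obtain ⟨ρ, φ, hPt, h1, -, -⟩ := hdesc t
    rw [hPt, norm_circleMap_zero]
    exact h1.trans (le_abs_self ρ)
  · obtain ⟨ρ, φ, hPt, h1, -, hcase⟩ := hdesc t
    have hρ : ρ = 1 := by
      rwa [hPt, norm_circleMap_zero, abs_of_pos (show (0 : ℝ) < ρ by linarith)] at ht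
    rcases hcase with (hφ | hφ) | ⟨hρr, -, -⟩
    · left
      rw [hPt, hρ, hφ]
    · right
      rw [hPt, hρ, hφ]
    · exact absurd (hρr.symm.trans hρ) hr.ne'

/-- **Registered stub `bb_round_connectors`: disjoint exterior connectors in the round model.**  For
angles `θ₁ < θ₂ < θ₄ < θ₃ < θ₁ + 2π` there are paths `P` from `e^{iθ₁}` to `e^{iθ₃}` and `Q` from
`e^{iθ₂}` to `e^{iθ₄}` with `‖P t‖ ≥ 1` everywhere and `‖P t‖ = 1` only at the two endpoints (as
points), the same for `Q`, and `range P ∩ range Q = ∅`.  (`P`: out to radius `2`, round, back; `Q`: the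
same at radius `3 / 2`.  A common point has a common norm `ρ ∈ [1, 3 / 2]`, so it is not on the arc of
`P`; on a radial piece of `P` its angle is `θ₁` or `θ₃`, on `Q` its angle lies in `[θ₂, θ₄]`, and these
are incongruent modulo `2π` — contradiction by `eq_of_circleMap_eq`.) [folklore] -/
theorem bb_round_connectors : ∀ (θ₁ θ₂ θ₃ θ₄ : ℝ), θ₁ < θ₂ → θ₂ < θ₄ → θ₄ < θ₃ → θ₃ < θ₁ + 2 * Real.pi → ∃ (P : Path (circleMap 0 1 θ₁) (circleMap 0 1 θ₃)) (Q : Path (circleMap 0 1 θ₂) (circleMap 0 1 θ₄)), (∀ t, 1 ≤ ‖P t‖) ∧ (∀ t, ‖P t‖ = 1 → P t = circleMap 0 1 θ₁ ∨ P t = circleMap 0 1 θ₃) ∧ (∀ t, 1 ≤ ‖Q t‖) ∧ (∀ t, ‖Q t‖ = 1 → Q t = circleMap 0 1 θ₂ ∨ Q t = circleMap 0 1 θ₄) ∧ ∀ s t, P s ≠ Q t := by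
  intro θ₁ θ₂ θ₃ θ₄ h12 h24 h43 h31
  obtain ⟨P, hP1, hP2, hPd⟩ := bbr_connector (show θ₁ ≤ θ₃ by linarith) (show (1 : ℝ) < 2 by norm_num)
  obtain ⟨Q, hQ1, hQ2, hQd⟩ := bbr_connector h24.le (show (1 : ℝ) < 3 / 2 by norm_num)
  refine ⟨P, Q, hP1, hP2, hQ1, hQ2, fun s t hst => ?_⟩
  obtain ⟨ρ, φ, hPs, hρ1, hρ2, hPc⟩ := hPd s
  obtain ⟨ρ', φ', hQt, hρ'1, hρ'2, hQc⟩ := hQd t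
  -- every point of `Q` has its angle in `[θ₂, θ₄]`
  have hφ' : θ₂ ≤ φ' ∧ φ' ≤ θ₄ := by
    rcases hQc with (hφ | hφ) | ⟨-, h1, h2⟩
    · exact ⟨hφ.ge, hφ.le.trans h24.le⟩
    · exact ⟨h24.le.trans hφ.ge, hφ.le⟩
    · exact ⟨h1, h2⟩
  rw [hPs, hQt] at hst
  -- a common point has a common norm
  have hρρ' : ρ' = ρ := by
    have h := norm_circleMap_zero ρ φ
    rwa [hst, norm_circleMap_zero, abs_of_pos (show (0 : ℝ) < ρ' by linarith),
      abs_of_pos (show (0 : ℝ) < ρ by linarith)] at h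
  subst hρρ'
  rcases hPc with hφ | ⟨hρ2', -, -⟩
  · -- radial piece of `P`: angle `θ₁` or `θ₃`, incongruent to `φ' ∈ [θ₂, θ₄]` modulo `2π`
    have hdist : |φ - φ'| < 2 * Real.pi := by
      rw [abs_lt]
      rcases hφ with hφ | hφ <;> rw [hφ] <;> constructor <;> linarith [hφ'.1, hφ'.2, Real.pi_pos]
    have key : φ = φ' := eq_of_circleMap_eq (zero_lt_one.trans_le hρ'1).ne' hdist hst
    rcases hφ with hφ | hφ <;> linarith [hφ'.1, hφ'.2]
  · -- arc of `P`: norm `2 > 3 / 2`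
    linarith

end Summit.CriticalPhenomena.SAWScalingLimit.Theorems.FKGToTraversalBound.SlitNecklace

end
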